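import Mathlib
import Summits.ValiantsHypothesis.ValiantsHypothesis.Theorems.NewtonUnitEquationsNewtonTauWeakCornerDefs

/-!
# `NewtonTauWeak` (stmt-ValiantsHypothesis-5904), line `binomial-normal-form`, stub `fixedKCoincidence_t2_K3`:
# generic real weights refining an integer weight

Support file for the registered sub-stub `fixedKCoincidence_t2_K3` (FixedKCoincidence at `t = 2`, `K = 3`,
under the "no short 2-vs-1 relation" hypothesis) of the crux
`Summit.ValiantsHypothesis.ValiantsHypothesis.Theses.NewtonUnitEquations.NewtonTauWeak`.

The local corner analysis (`corner_rigidity`, `…CornerRigidity.lean`) is stated for a REAL weight `w` whose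
pairing `wt w : ℤ² → ℝ` is injective on the whole lattice.  A combinatorial Newton vertex, on the other hand,
comes with an INTEGER weight `w₀` that is only injective near the vertex (integer gaps `≥ 1` on a finite set).
This file bridges the two: `w := (M w₀₀ + 1, M w₀₁ + √2)` for a large integer `M` is injective on `ℤ²`
(irrationality of `√2`) and keeps every prescribed finite family of positive integer gaps positive.

Main result: `exists_generic_weight`.  No definitions. [folklore]
-/

-- the namespace mandated for this Theorems file repeats the component `ValiantsHypothesis`
set_option linter.dupNamespace false

noncomputable section

open scoped BigOperators

namespace Summit.ValiantsHypothesis.ValiantsHypothesis.Theorems.NewtonTauWeakCorner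

/-- If `q + √2 · d = 0` with integers `q, d`, then `d = 0` (irrationality of `√2`). [folklore] -/
theorem int_eq_zero_of_add_sqrt_two_mul_eq_zero (q d : ℤ) (h : (q : ℝ) + Real.sqrt 2 * (d : ℝ) = 0) :
    d = 0 := by
  by_contra hd
  have hd' : (d : ℝ) ≠ 0 := by exact_mod_cast hd
  have hsq : Real.sqrt 2 = ((-q : ℤ) : ℝ) / ((d : ℤ) : ℝ) := by
    rw [eq_div_iff hd']
    push_cast
    linarith
  exact (irrational_sqrt_two.ne_rational (-q) d) hsq

/-- **Generic refinement of an integer weight.**  For an integer weight `w₀` and a finite set `A ⊆ ℤ²` of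
lattice vectors of `w₀`-weight `≥ 1`, there is a real weight `w` whose pairing `wt w` is injective on `ℤ²`
and positive on `A`.  (Take `w = (M w₀₀ + 1, M w₀₁ + √2)` with `M` exceeding `2 + Σ_{a∈A} (|a₀| + 2|a₁|)`.)
[folklore] -/
theorem exists_generic_weight (w₀ : Fin 2 → ℤ) (A : Finset (Fin 2 → ℤ))
    (hA : ∀ a ∈ A, 1 ≤ w₀ 0 * a 0 + w₀ 1 * a 1) :
    ∃ w : Fin 2 → ℝ, Function.Injective (wt w) ∧ ∀ a ∈ A, 0 < wt w a := by
  -- the scale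
  set M : ℤ := 2 + ∑ a ∈ A, (|a 0| + 2 * |a 1|) with hM
  have hM2 : 2 ≤ M := by
    have : 0 ≤ ∑ a ∈ A, (|a 0| + 2 * |a 1|) := Finset.sum_nonneg fun a _ => by positivity
    omega
  have hMa : ∀ a ∈ A, |a 0| + 2 * |a 1| + 2 ≤ M := by
    intro a ha
    have := Finset.single_le_sum (f := fun a : Fin 2 → ℤ => |a 0| + 2 * |a 1|)
      (fun a _ => by positivity) ha
    omega
  refine ⟨![(M : ℝ) * w₀ 0 + 1, (M : ℝ) * w₀ 1 + Real.sqrt 2], ?_, ?_⟩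
  · -- injectivity
    intro z z' hzz
    simp only [wt, Matrix.cons_val_zero, Matrix.cons_val_one, Matrix.cons_val_fin_one] at hzz
    have key : (((M * w₀ 0 + 1) * (z 0 - z' 0) + M * w₀ 1 * (z 1 - z' 1) : ℤ) : ℝ)
        + Real.sqrt 2 * ((z 1 - z' 1 : ℤ) : ℝ) = 0 := by
      push_cast
      linarith
    have h1 := int_eq_zero_of_add_sqrt_two_mul_eq_zero _ _ key
    have h1' : z 1 = z' 1 := by omega
    rw [h1] at key
    simp only [mul_zero, add_zero, Int.cast_zero] at key
    have h0 : (M * w₀ 0 + 1) * (z 0 - z' 0) = 0 := by exact_mod_cast key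
    have hM0 : M * w₀ 0 + 1 ≠ 0 := by
      intro h
      have h2 : M * w₀ 0 = -1 := by omega
      have h3 : M ∣ 1 := ⟨-w₀ 0, by linarith⟩
      have := Int.le_of_dvd one_pos h3
      omega
    have h0' : z 0 = z' 0 := by
      have := (mul_eq_zero.mp h0).resolve_left hM0
      omega
    funext i
    fin_cases i
    · exact h0'
    · exact h1'
  · -- positivity on `A`
    intro a ha
    have hgap := hA a ha
    have hbd := hMa a ha
    simp only [wt, Matrix.cons_val_zero, Matrix.cons_val_one, Matrix.cons_val_fin_one]
    have hs2 : Real.sqrt 2 < 2 := by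
      rw [show (2 : ℝ) = Real.sqrt 4 by
        rw [show (4 : ℝ) = 2 ^ 2 by norm_num, Real.sqrt_sq (by norm_num)]]
      exact Real.sqrt_lt_sqrt (by norm_num) (by norm_num)
    have hs0 : 0 ≤ Real.sqrt 2 := Real.sqrt_nonneg 2
    have e1 : ((M : ℝ) * w₀ 0 + 1) * (a 0 : ℝ) + ((M : ℝ) * w₀ 1 + Real.sqrt 2) * (a 1 : ℝ)
        = (M : ℝ) * ((w₀ 0 : ℝ) * (a 0 : ℝ) + (w₀ 1 : ℝ) * (a 1 : ℝ)) + (a 0 : ℝ)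
          + Real.sqrt 2 * (a 1 : ℝ) := by
      ring
    rw [e1]
    have hM0 : (0 : ℤ) ≤ M := by omega
    have hMX : M ≤ M * (w₀ 0 * a 0 + w₀ 1 * a 1) := le_mul_of_one_le_right hM0 hgap
    have hlow : |a 0| + 2 * |a 1| + 2 ≤ M * (w₀ 0 * a 0 + w₀ 1 * a 1) := hbd.trans hMX
    have hlowR : |(a 0 : ℝ)| + 2 * |(a 1 : ℝ)| + 2
        ≤ (M : ℝ) * ((w₀ 0 : ℝ) * (a 0 : ℝ) + (w₀ 1 : ℝ) * (a 1 : ℝ)) := by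
      have := (Int.cast_le (R := ℝ)).mpr hlow
      push_cast [Int.cast_abs] at this
      exact this
    have hb0 : -|(a 0 : ℝ)| ≤ (a 0 : ℝ) := neg_abs_le _
    have hsa : -(2 * |(a 1 : ℝ)|) ≤ Real.sqrt 2 * (a 1 : ℝ) := by
      have h1 : |Real.sqrt 2 * (a 1 : ℝ)| ≤ 2 * |(a 1 : ℝ)| := by
        rw [abs_mul, abs_of_nonneg hs0]
        exact mul_le_mul_of_nonneg_right hs2.le (abs_nonneg _)
      have h2 := neg_abs_le (Real.sqrt 2 * (a 1 : ℝ))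
      linarith
    linarith
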